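import Mathlib.Analysis.Calculus.MeanValue
import Mathlib.Geometry.Manifold.PartitionOfUnity
import Literature.Geometry.Kaehler.PoincareLemmaFlat
import HarnessLib

/-!
# The Poincaré lemma on star-shaped open subsets of a finite-dimensional space

Support for the finite-dimensionality of de Rham cohomology
(`Literature.AlgebraicGeometry.Motives.finite_deRhamCohomology`). Continuation of
`Literature.Geometry.Kaehler.PoincareLemmaFlat` (the radial homotopy operator `coneOperator x₀`
and the homotopy formula `d (K ω) + K (dω) = ω` for globally smooth forms): here the operator is
localised, by smooth cut-offs equal to `1` near a segment, to forms that are `C^∞` only on an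
open set `U` star-shaped with respect to `x₀` (`contDiffOn_coneOperator`,
`extDeriv_coneOperator_add_of_starConvex`), which gives the **Poincaré lemma**: on such `U` a
closed form of positive degree that is `C^∞` on `U` is `d` of a form `C^∞` on `U`
(`exists_extDeriv_eq_of_starConvex`, Lee (2013), Thm. 17.14), and a closed `0`-form takes a
single value (`eq_of_extDeriv_eq_zero_of_starConvex`, Lee (2013), Prop. 17.6).

## References

* J. M. Lee, *Introduction to Smooth Manifolds*, 2nd ed. (2013), Thm. 17.14, Prop. 17.6.
* R. Bott, L. W. Tu, *Differential Forms in Algebraic Topology* (1982), §I.4, Cor. 4.1.1.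
-/

noncomputable section

open scoped Topology ContDiff Manifold
open Set Filter MeasureTheory intervalIntegral ContinuousAlternatingMap

namespace Literature.Geometry.Kaehler

variable {E : Type*} [NormedAddCommGroup E] [NormedSpace ℝ E]
  {F : Type*} [NormedAddCommGroup F] [NormedSpace ℝ F] {k : ℕ}

/-! ### Localisation: the Poincaré lemma on star-shaped open sets -/

section Local

/-- Segments are compact. [folklore] -/
theorem isCompact_segment' (x y : E) : IsCompact (segment ℝ x y) := by
  rw [segment_eq_image']
  exact isCompact_Icc.image (continuous_const.add (continuous_id.smul continuous_const))

/-- A `C^∞` function times a form that is `C^∞` on an open set `U` is globally `C^∞` as soon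
as the function vanishes near `Uᶜ`. [folklore] -/
theorem contDiff_smul_of_eventuallyEq_zero {U : Set E} (hU : IsOpen U) {ψ : E → ℝ}
    (hψ : ContDiff ℝ ∞ ψ) (h0 : ∀ᶠ y in 𝓝ˢ Uᶜ, ψ y = 0) {n : ℕ}
    {β : E → E [⋀^Fin n]→L[ℝ] F} (hβ : ContDiffOn ℝ ∞ β U) :
    ContDiff ℝ ∞ fun y ↦ ψ y • β y := by
  refine contDiff_iff_contDiffAt.2 fun y ↦ ?_
  by_cases hy : y ∈ U
  · exact hψ.contDiffAt.smul (hβ.contDiffAt (hU.mem_nhds hy))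
  · have h : (fun y ↦ ψ y • β y) =ᶠ[𝓝 y] fun _ ↦ 0 := by
      have h0' : ∀ᶠ z in 𝓝 y, ψ z = 0 := (h0.filter_mono (nhds_le_nhdsSet hy) :)
      filter_upwards [h0'] with z hz
      rw [hz, zero_smul]
    exact (contDiffAt_const (c := (0 : E [⋀^Fin n]→L[ℝ] F))).congr_of_eventuallyEq h

/-- For a `0`-form `f`, `df x = 0` forces `Df x = 0`: the alternatization is injective in degree
`0`. [folklore] -/
theorem fderiv_eq_zero_of_extDeriv_eq_zero {f : E → E [⋀^Fin 0]→L[ℝ] F} {x : E}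
    (h : extDeriv f x = 0) : fderiv ℝ f x = 0 := by
  ext v w
  have hv := congrArg (fun g : E [⋀^Fin (0 + 1)]→L[ℝ] F ↦ g (fun _ ↦ v)) h
  simp only [extDeriv, alternatizeUncurryFin_apply, Fin.sum_univ_succ, Finset.univ_eq_empty,
    Finset.sum_empty, add_zero, Fin.val_zero, pow_zero, one_smul] at hv
  rw [Subsingleton.elim w (Fin.removeNth 0 fun _ : Fin (0 + 1) ↦ v)]
  simpa using hv

/-- **Poincaré lemma in degree `0` on star-shaped open sets**: a differentiable `0`-form whose
exterior derivative vanishes on an open set `U` star-shaped with respect to `x₀` takes at every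
point of `U` its value at `x₀` (integrate `Df = 0` along segments from `x₀`).
Lee (2013), Prop. 17.6 / Thm. 17.14. [cite: LeeSmoothManifolds2013, Prop. 17.6] -/
theorem eq_of_extDeriv_eq_zero_of_starConvex {U : Set E} {x₀ : E} (hU : IsOpen U)
    (hst : StarConvex ℝ x₀ U) {f : E → E [⋀^Fin 0]→L[ℝ] F} (hf : DifferentiableOn ℝ f U)
    (hd : ∀ x ∈ U, extDeriv f x = 0) {p : E} (hp : p ∈ U) : f p = f x₀ := by
  have hS : segment ℝ x₀ p ⊆ U := hst.segment_subset hp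
  set g : ℝ → E [⋀^Fin 0]→L[ℝ] F := fun t ↦ f (x₀ + t • (p - x₀)) with hg
  have hmem : ∀ t ∈ Icc (0 : ℝ) 1, x₀ + t • (p - x₀) ∈ U := fun t ht ↦
    hS (by rw [segment_eq_image']; exact ⟨t, ht, rfl⟩)
  have hderiv : ∀ t ∈ Icc (0 : ℝ) 1, HasDerivAt g 0 t := by
    intro t ht
    have hγ : HasDerivAt (fun t : ℝ ↦ x₀ + t • (p - x₀)) (p - x₀) t := by
      simpa using ((hasDerivAt_id t).smul_const (p - x₀)).const_add x₀
    have hfd : HasFDerivAt f (fderiv ℝ f (x₀ + t • (p - x₀))) (x₀ + t • (p - x₀)) :=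
      (hf.differentiableAt (hU.mem_nhds (hmem t ht))).hasFDerivAt
    have h : HasDerivAt g (fderiv ℝ f (x₀ + t • (p - x₀)) (p - x₀)) t := hfd.comp_hasDerivAt t hγ
    rw [fderiv_eq_zero_of_extDeriv_eq_zero (hd _ (hmem t ht))] at h
    exact h
  have hconst := constant_of_derivWithin_zero (f := g) (a := 0) (b := 1)
    (fun t ht ↦ (hderiv t ht).differentiableAt.differentiableWithinAt)
    (fun t ht ↦ by
      rw [(hderiv t (Ico_subset_Icc_self ht)).hasDerivWithinAt.derivWithin
        (uniqueDiffOn_Icc zero_lt_one t (Ico_subset_Icc_self ht))])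
    1 (right_mem_Icc.2 zero_le_one)
  simpa [hg] using hconst

/-- Segments from `x₀` to points near `p` stay inside any neighbourhood of the segment
`[x₀, p]`. [folklore] -/
theorem eventually_segment_subset {x₀ p : E} {N : Set E} (hN : IsOpen N)
    (hS : segment ℝ x₀ p ⊆ N) :
    ∀ᶠ q in 𝓝 p, ∀ t ∈ Icc (0 : ℝ) 1, x₀ + t • (q - x₀) ∈ N := by
  obtain ⟨δ, hδ, hδN⟩ := (isCompact_segment' x₀ p).exists_thickening_subset_open hN hS
  filter_upwards [Metric.ball_mem_nhds p hδ] with q hq t ht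
  refine hδN (Metric.mem_thickening_iff.2 ⟨x₀ + t • (p - x₀), ?_, ?_⟩)
  · rw [segment_eq_image']
    exact ⟨t, ht, rfl⟩
  · rw [dist_eq_norm]
    have h1 : x₀ + t • (q - x₀) - (x₀ + t • (p - x₀)) = t • (q - p) := by
      rw [add_sub_add_left_eq_sub, ← smul_sub, sub_sub_sub_cancel_right]
    rw [h1, norm_smul, Real.norm_eq_abs, abs_of_nonneg ht.1]
    calc t * ‖q - p‖ ≤ 1 * ‖q - p‖ := by gcongr; exact ht.2
      _ < δ := by rw [one_mul, ← dist_eq_norm]; exact hq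

variable [FiniteDimensional ℝ E]

/-- **Smooth cut-off functions.** For a compact subset `K` of an open set `U` of a
finite-dimensional space there is a `C^∞` function equal to `1` near `K` and to `0` near `Uᶜ`
(smooth Urysohn lemma, Mathlib's `exists_contMDiffMap_zero_one_nhds_of_isClosed`).
[folklore] -/
theorem exists_contDiff_one_nhdsSet_of_isCompact {K U : Set E} (hK : IsCompact K) (hU : IsOpen U)
    (hKU : K ⊆ U) :
    ∃ ψ : E → ℝ, ContDiff ℝ ∞ ψ ∧ (∀ᶠ y in 𝓝ˢ K, ψ y = 1) ∧ ∀ᶠ y in 𝓝ˢ Uᶜ, ψ y = 0 := by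
  obtain ⟨f, hf0, hf1, -⟩ := exists_contMDiffMap_zero_one_nhds_of_isClosed 𝓘(ℝ, E) (n := ⊤)
    hU.isClosed_compl hK.isClosed (disjoint_compl_left_iff_subset.2 hKU)
  exact ⟨f, contMDiff_iff_contDiff.1 f.contMDiff, hf1, hf0⟩

variable {U : Set E} {x₀ : E}

/-- **Localisation of the homotopy operator.** On an open set `U` star-shaped with respect to
`x₀`, for a form `β` that is `C^∞` on `U` and a point `p ∈ U`, there is a globally `C^∞` form
`β'` (`β` times a cut-off equal to `1` near the segment `[x₀, p]`) that agrees with `β` near every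
point of `[x₀, p]` and whose cone transform agrees with that of `β` near `p`. [folklore] -/
theorem exists_contDiff_coneOperator_eventuallyEq (hU : IsOpen U) (hst : StarConvex ℝ x₀ U)
    {β : E → E [⋀^Fin (k + 1)]→L[ℝ] F} (hβ : ContDiffOn ℝ ∞ β U) {p : E} (hp : p ∈ U) :
    ∃ β' : E → E [⋀^Fin (k + 1)]→L[ℝ] F, ContDiff ℝ ∞ β' ∧
      (∀ t ∈ Icc (0 : ℝ) 1, ∀ᶠ y in 𝓝 (x₀ + t • (p - x₀)), β' y = β y) ∧
      ∀ᶠ q in 𝓝 p, coneOperator x₀ β' q = coneOperator x₀ β q := by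
  have hS : segment ℝ x₀ p ⊆ U := hst.segment_subset hp
  obtain ⟨ψ, hψ, h1, h0⟩ := exists_contDiff_one_nhdsSet_of_isCompact (isCompact_segment' x₀ p) hU hS
  obtain ⟨N, hN, hSN, hNs⟩ := mem_nhdsSet_iff_exists.1 h1
  have hN1 : ∀ y ∈ N, ψ y = 1 := fun y hy ↦ hNs hy
  refine ⟨fun y ↦ ψ y • β y, contDiff_smul_of_eventuallyEq_zero hU hψ h0 hβ, ?_, ?_⟩
  · intro t ht
    have hm : x₀ + t • (p - x₀) ∈ N := hSN (by rw [segment_eq_image']; exact ⟨t, ht, rfl⟩)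
    filter_upwards [hN.mem_nhds hm] with y hy
    rw [hN1 y hy, one_smul]
  · filter_upwards [eventually_segment_subset hN hSN] with q hq
    exact coneOperator_congr x₀ fun t ht ↦ by rw [hN1 _ (hq t ht), one_smul]

/-- **The homotopy operator on a star-shaped open set preserves smoothness**: if `β` is `C^∞`
on an open `U` star-shaped with respect to `x₀`, so is `K β` (localisation of
`contDiff_coneOperator` by cut-offs). [folklore] -/
theorem contDiffOn_coneOperator (hU : IsOpen U) (hst : StarConvex ℝ x₀ U)
    {β : E → E [⋀^Fin (k + 1)]→L[ℝ] F} (hβ : ContDiffOn ℝ ∞ β U) :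
    ContDiffOn ℝ ∞ (coneOperator x₀ β) U := by
  intro p hp
  obtain ⟨β', hβ', -, hK⟩ := exists_contDiff_coneOperator_eventuallyEq hU hst hβ hp
  exact ((contDiff_coneOperator x₀ hβ').contDiffAt.congr_of_eventuallyEq
    (hK.mono fun q hq ↦ hq.symm)).contDiffWithinAt

/-- **The homotopy formula on a star-shaped open set**: `d (K β) p + K (dβ) p = β p` at every
point `p` of an open set `U` star-shaped with respect to `x₀`, for `β` of positive degree and
`C^∞` on `U` (`F` complete). Bott–Tu (1982), §I.4; Lee (2013), Thm. 17.14.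
[cite: BottTu1982Forms, §I.4] -/
theorem extDeriv_coneOperator_add_of_starConvex [CompleteSpace F] (hU : IsOpen U)
    (hst : StarConvex ℝ x₀ U) {β : E → E [⋀^Fin (k + 1)]→L[ℝ] F} (hβ : ContDiffOn ℝ ∞ β U)
    {p : E} (hp : p ∈ U) :
    extDeriv (coneOperator x₀ β) p + coneOperator x₀ (extDeriv β) p = β p := by
  obtain ⟨β', hβ', hseg, hK⟩ := exists_contDiff_coneOperator_eventuallyEq hU hst hβ hp
  have h1 : extDeriv (coneOperator x₀ β) p = extDeriv (coneOperator x₀ β') p :=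
    (Filter.EventuallyEq.extDeriv_eq (hK.mono fun q hq ↦ hq.symm))
  have h2 : coneOperator x₀ (extDeriv β) p = coneOperator x₀ (extDeriv β') p :=
    coneOperator_congr x₀ fun t ht ↦
      (Filter.EventuallyEq.extDeriv_eq (hseg t ht : β' =ᶠ[𝓝 _] β)).symm
  have h3 : β p = β' p := by
    have h := (hseg 1 (right_mem_Icc.2 zero_le_one)).self_of_nhds
    simp only [one_smul, add_sub_cancel] at h
    exact h.symm
  rw [h1, h2, h3]
  exact extDeriv_coneOperator_add x₀ hβ' p

/-- **Poincaré lemma (positive degree) on star-shaped open sets.** On an open subset `U` of a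
finite-dimensional real normed space, star-shaped with respect to `x₀`, every `(k+1)`-form that
is `C^∞` on `U` and closed on `U` is, on `U`, the exterior derivative of a `k`-form `C^∞` on
`U` — namely of `K β` (`F` complete). Lee (2013), Thm. 17.14; Bott–Tu (1982), Cor. 4.1.1;
Warner (1983), 4.18. [cite: LeeSmoothManifolds2013, Thm. 17.14] -/
theorem extDeriv_coneOperator_of_extDeriv_eq_zero [CompleteSpace F] (hU : IsOpen U)
    (hst : StarConvex ℝ x₀ U) {β : E → E [⋀^Fin (k + 1)]→L[ℝ] F} (hβ : ContDiffOn ℝ ∞ β U)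
    (hd : ∀ x ∈ U, extDeriv β x = 0) {p : E} (hp : p ∈ U) :
    extDeriv (coneOperator x₀ β) p = β p := by
  have h := extDeriv_coneOperator_add_of_starConvex hU hst hβ hp
  have h0 : coneOperator x₀ (extDeriv β) p = 0 := by
    have hS : segment ℝ x₀ p ⊆ U := hst.segment_subset hp
    have h1 : coneOperator x₀ (extDeriv β) p =
        coneOperator x₀ (0 : E → E [⋀^Fin (k + 1 + 1)]→L[ℝ] F) p :=
      coneOperator_congr x₀ fun t ht ↦ by
        rw [Pi.zero_apply]
        exact hd _ (hS (by rw [segment_eq_image']; exact ⟨t, ht, rfl⟩))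
    rw [h1, coneOperator_zero, Pi.zero_apply]
  rwa [h0, add_zero] at h

/-- **Poincaré lemma (positive degree), existence form.** [cite: LeeSmoothManifolds2013, Thm. 17.14] -/
theorem exists_extDeriv_eq_of_starConvex [CompleteSpace F] (hU : IsOpen U)
    (hst : StarConvex ℝ x₀ U) {β : E → E [⋀^Fin (k + 1)]→L[ℝ] F} (hβ : ContDiffOn ℝ ∞ β U)
    (hd : ∀ x ∈ U, extDeriv β x = 0) :
    ∃ γ : E → E [⋀^Fin k]→L[ℝ] F, ContDiffOn ℝ ∞ γ U ∧ ∀ x ∈ U, extDeriv γ x = β x :=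
  ⟨coneOperator x₀ β, contDiffOn_coneOperator hU hst hβ,
    fun _ hx ↦ extDeriv_coneOperator_of_extDeriv_eq_zero hU hst hβ hd hx⟩

end Local

end Literature.Geometry.Kaehler
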